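import Summits.CriticalPhenomena.Ising3DConformalLimit.Theorems.SynchronousCouplingRotationJoiningIsotropyDefs
import Literature.Probability.LatticeModels.CriticalGibbsUniqueness
import Literature.Probability.LatticeModels.CriticalBlockMoments
import HarnessLib

/-!
# Route `SynchronousCoupling`, crux `RotationJoining` (stmt-CriticalPhenomena-18763), line `SketchIdeator2` (reshape 2) —
# mixed block moments of the critical state as smeared correlators (lead's tools for `stub_isotropyTransfer`)

* `criticalState_of_mem'` — every `μ ∈ 𝒢(β_c, 0)` on `ℤ³` is the plus state (a probability measure computing `plusCorr`).
* `integral_prod_blockSum_eq_sum` — `E_μ[∏ₗ B(Pₗ)] = Σ_{y ∈ ∏ₗ Pₗ} ⟨∏ₗ σ_{yₗ}⟩_{β_c}` for finite cells `Pₗ` (`B(P) = Σ_{x∈P} σ_x`).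
* `integral_pairSum_mul_prod_eq_sum` — the CONSTRAINED version: for `a ≠ b` and a set of pairs `C ⊆ P_a × P_b`,
  `E_μ[(Σ_{c∈C} σ_{c₁}σ_{c₂}) ∏_{l ∉ {a,b}} B(Pₗ)] = Σ_{y ∈ ∏ Pₗ, (y_a,y_b) ∈ C} ⟨∏σ_{yₗ}⟩` (the indicator of `C` is a sum of
  products of one-site indicators, so `Finset.prod_univ_sum` factorises the constrained sum as well).
* `sum_piFinset_image_psiInv` — sums over products of TILTED cells are sums over products of axis cells composed with `ψ⁻¹`
  (`TiltGeometry` (4) and injectivity of `ψ⁻¹`).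
References: S. Friedli, Y. Velenik (CUP 2017) Thm. 3.17/3.28/6.26; G. Kozma, Acta Math. 199 (2007) §6.1. No definitions, no sorry.
-/

noncomputable section

namespace Summit.CriticalPhenomena.Ising3DConformalLimit.Cruxes.RotationJoining.RateSplitting

open MeasureTheory Filter Literature.Probability.LatticeModels
open scoped BigOperators

/-- **Identification of the critical state.** Every `μ ∈ 𝒢(β_c(3), 0)` is the plus state: a probability measure with
`⟨σ_A⟩_μ = ⟨σ_A⟩⁺_{β_c(3),0}` for every finite `A` (`hasUniqueGibbsMeasure_criticalBeta_holds`, `exists_plusMeasure_holds`).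
[cite: FriedliVelenik2017, Thm. 3.28 with Prop. 3.29 / Thm. 6.63] -/
theorem criticalState_of_mem' {μ : Measure (SpinConfig (Site 3))} (hμ : μ ∈ isingGibbsMeasures 3 (criticalBeta 3) 0) :
    IsProbabilityMeasure μ ∧ ∀ A : Finset (Site 3), spinCorr μ A = plusCorr 3 (criticalBeta 3) 0 A := by
  obtain ⟨μp, hμp, -, hcorr⟩ :=
    exists_plusMeasure_holds (d := 3) (β := criticalBeta 3) (h := (0 : ℝ)) (criticalBeta_nonneg 3)
  have huniq := hasUniqueGibbsMeasure_criticalBeta_holds (d := 3) (by norm_num)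
  have hμeq : μ = μp := huniq.1 hμ hμp
  subst hμeq
  exact ⟨((mem_isingGibbsMeasures_iff 3 _ 0 μ).1 hμ).isProbabilityMeasure, hcorr⟩

/-- Spin monomials are integrable against a finite measure (they are bounded by `1`). [folklore] -/
theorem integrable_spinMonomial' (μ : Measure (SpinConfig (Site 3))) [IsFiniteMeasure μ] {n : ℕ}
    (y : Fin n → Site 3) : Integrable (spinMonomial y) μ :=
  Integrable.of_bound (measurable_spinMonomial y).aestronglyMeasurable 1
    (Eventually.of_forall fun s => by
      rw [Real.norm_eq_abs]
      simp [spinMonomial, Finset.abs_prod])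

/-- The product of block spins is the smeared spin monomial: `∏ₗ Σ_{x ∈ Pₗ} σ_x = Σ_{y ∈ ∏ₗ Pₗ} ∏ₗ σ_{yₗ}`. [folklore] -/
theorem prod_blockSum_eq_sum_spinMonomial {k : ℕ} (P : Fin k → Finset (Site 3)) (σ : SpinConfig (Site 3)) :
    ∏ l, blockSum (P l) σ = ∑ y ∈ Fintype.piFinset P, spinMonomial y σ := by
  simp only [blockSum, spinMonomial]
  exact Finset.prod_univ_sum P fun l x => spinAt x σ

/-- **Mixed block moments are smeared correlators.** For a measure with the plus correlations at `β_c` and finite cells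
`Pₗ ⊆ ℤ³`, `∫ ∏ₗ (Σ_{x∈Pₗ} σ_x) dμ = Σ_{y ∈ ∏ₗ Pₗ} ⟨∏ₗ σ_{yₗ}⟩_{β_c}`. [cite: FriedliVelenik2017, Thm. 3.17 and Thm. 6.26] -/
theorem integral_prod_blockSum_eq_sum {μ : Measure (SpinConfig (Site 3))} [IsFiniteMeasure μ]
    (hcorr : ∀ A : Finset (Site 3), spinCorr μ A = plusCorr 3 (criticalBeta 3) 0 A)
    {k : ℕ} (P : Fin k → Finset (Site 3)) :
    ∫ σ, ∏ l, blockSum (P l) σ ∂μ = ∑ y ∈ Fintype.piFinset P, criticalCorr 3 k y := by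
  simp_rw [prod_blockSum_eq_sum_spinMonomial P]
  rw [integral_finsetSum _ fun y _ => integrable_spinMonomial' μ y]
  exact Finset.sum_congr rfl fun y _ => (criticalCorr_eq_integral_spinMonomial hcorr y).symm

/-- Pointwise factorisation of the CONSTRAINED smeared monomial: for `a ≠ b` and `C ⊆ P_a × P_b`,
`Σ_{y ∈ ∏ Pₗ, (y_a, y_b) ∈ C} ∏ₗ σ_{yₗ} = (Σ_{c ∈ C} σ_{c₁} σ_{c₂}) · ∏ₗ (if l ∈ {a,b} then 1 else Σ_{x∈Pₗ} σ_x)`. [folklore] -/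
theorem sum_filter_pair_spinMonomial {k : ℕ} (P : Fin k → Finset (Site 3)) {a b : Fin k} (hab : a ≠ b)
    (C : Finset (Site 3 × Site 3)) (hC : C ⊆ P a ×ˢ P b) (σ : SpinConfig (Site 3)) :
    ∑ y ∈ (Fintype.piFinset P).filter (fun y => (y a, y b) ∈ C), spinMonomial y σ =
      (∑ c ∈ C, spinAt c.1 σ * spinAt c.2 σ) *
        ∏ l, (if l = a ∨ l = b then (1:ℝ) else blockSum (P l) σ) := by
  classical
  -- one-site indicator weights for a fixed pair `c`
  have key : ∀ c ∈ C,
      ∑ y ∈ Fintype.piFinset P, (if y a = c.1 ∧ y b = c.2 then spinMonomial y σ else 0) =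
        spinAt c.1 σ * spinAt c.2 σ * ∏ l, (if l = a ∨ l = b then (1:ℝ) else blockSum (P l) σ) := by
    intro c hc
    have hc' := hC hc
    rw [Finset.mem_product] at hc'
    -- weights per coordinate
    set f : ∀ l : Fin k, Site 3 → ℝ := fun l x =>
      if l = a then (if x = c.1 then spinAt x σ else 0)
      else if l = b then (if x = c.2 then spinAt x σ else 0) else spinAt x σ with hf
    have hprod : ∀ y ∈ Fintype.piFinset P,
        (if y a = c.1 ∧ y b = c.2 then spinMonomial y σ else 0) = ∏ l, f l (y l) := by
      intro y _
      by_cases h : y a = c.1 ∧ y b = c.2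
      · rw [if_pos h, spinMonomial]
        refine Finset.prod_congr rfl fun l _ => ?_
        simp only [hf]
        by_cases hla : l = a
        · subst hla; simp [h.1]
        · by_cases hlb : l = b
          · subst hlb; simp [hla, h.2]
          · simp [hla, hlb]
      · rw [if_neg h]
        rw [not_and_or] at h
        rcases h with h | h
        · symm
          apply Finset.prod_eq_zero (Finset.mem_univ a)
          simp [hf, h]
        · symm
          apply Finset.prod_eq_zero (Finset.mem_univ b)
          simp [hf, hab.symm, h]
    rw [Finset.sum_congr rfl hprod, ← Finset.prod_univ_sum P f]
    -- evaluate the three kinds of factors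
    have hfa : ∑ x ∈ P a, f a x = spinAt c.1 σ := by
      simp only [hf, if_true]
      rw [Finset.sum_ite_eq' (P a) c.1 (fun x => spinAt x σ), if_pos hc'.1]
    have hfb : ∑ x ∈ P b, f b x = spinAt c.2 σ := by
      simp only [hf, hab.symm, if_false, if_true]
      rw [Finset.sum_ite_eq' (P b) c.2 (fun x => spinAt x σ), if_pos hc'.2]
    have hfl : ∀ l, l ≠ a → l ≠ b → ∑ x ∈ P l, f l x = blockSum (P l) σ := by
      intro l hla hlb
      simp only [hf, hla, hlb, if_false, blockSum]
    -- split the product at `a` and `b`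
    rw [← Finset.mul_prod_erase Finset.univ _ (Finset.mem_univ a),
      ← Finset.mul_prod_erase _ _ (Finset.mem_erase.2 ⟨hab.symm, Finset.mem_univ b⟩), hfa, hfb]
    rw [← Finset.mul_prod_erase Finset.univ (fun l => if l = a ∨ l = b then (1:ℝ) else blockSum (P l) σ)
        (Finset.mem_univ a),
      ← Finset.mul_prod_erase _ (fun l => if l = a ∨ l = b then (1:ℝ) else blockSum (P l) σ)
        (Finset.mem_erase.2 ⟨hab.symm, Finset.mem_univ b⟩)]
    simp only [true_or, or_true, if_true, one_mul, mul_assoc]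
    congr 2
    refine Finset.prod_congr rfl fun l hl => ?_
    rw [Finset.mem_erase, Finset.mem_erase] at hl
    rw [hfl l hl.2.1 hl.1, if_neg (not_or.2 ⟨hl.2.1, hl.1⟩)]
  -- sum over `c ∈ C`
  calc ∑ y ∈ (Fintype.piFinset P).filter (fun y => (y a, y b) ∈ C), spinMonomial y σ
      = ∑ y ∈ Fintype.piFinset P, (if (y a, y b) ∈ C then spinMonomial y σ else 0) := by
        rw [Finset.sum_filter]
    _ = ∑ y ∈ Fintype.piFinset P, ∑ c ∈ C, (if y a = c.1 ∧ y b = c.2 then spinMonomial y σ else 0) := by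
        refine Finset.sum_congr rfl fun y _ => ?_
        by_cases h : (y a, y b) ∈ C
        · rw [if_pos h]
          rw [Finset.sum_eq_single (y a, y b)]
          · simp
          · rintro c - hc
            rw [if_neg]
            rintro ⟨h1, h2⟩
            exact hc (Prod.ext h1.symm h2.symm)
          · exact fun h' => absurd h h'
        · rw [if_neg h]
          symm
          refine Finset.sum_eq_zero fun c hc => ?_
          rw [if_neg]
          rintro ⟨h1, h2⟩
          apply h
          rw [show (y a, y b) = c from Prod.ext h1 h2]
          exact hc
    _ = ∑ c ∈ C, ∑ y ∈ Fintype.piFinset P, (if y a = c.1 ∧ y b = c.2 then spinMonomial y σ else 0) :=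
        Finset.sum_comm
    _ = ∑ c ∈ C, spinAt c.1 σ * spinAt c.2 σ * ∏ l, (if l = a ∨ l = b then (1:ℝ) else blockSum (P l) σ) :=
        Finset.sum_congr rfl key
    _ = _ := by rw [Finset.sum_mul]

/-- **Constrained mixed moments are constrained smeared correlators.** For `a ≠ b` and a set of pairs `C ⊆ P_a × P_b`,
`∫ (Σ_{c∈C} σ_{c₁}σ_{c₂}) · ∏ₗ (if l ∈ {a,b} then 1 else Σ_{x∈Pₗ} σ_x) dμ = Σ_{y ∈ ∏ Pₗ, (y_a,y_b) ∈ C} ⟨∏ₗ σ_{yₗ}⟩_{β_c}`.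
[cite: FriedliVelenik2017, Thm. 3.17 and Thm. 6.26] -/
theorem integral_pairSum_mul_prod_eq_sum {μ : Measure (SpinConfig (Site 3))} [IsFiniteMeasure μ]
    (hcorr : ∀ A : Finset (Site 3), spinCorr μ A = plusCorr 3 (criticalBeta 3) 0 A)
    {k : ℕ} (P : Fin k → Finset (Site 3)) {a b : Fin k} (hab : a ≠ b)
    (C : Finset (Site 3 × Site 3)) (hC : C ⊆ P a ×ˢ P b) :
    ∫ σ, (∑ c ∈ C, spinAt c.1 σ * spinAt c.2 σ) * ∏ l, (if l = a ∨ l = b then (1:ℝ) else blockSum (P l) σ) ∂μ =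
      ∑ y ∈ (Fintype.piFinset P).filter (fun y => (y a, y b) ∈ C), criticalCorr 3 k y := by
  simp_rw [← sum_filter_pair_spinMonomial P hab C hC]
  rw [integral_finsetSum _ fun y _ => integrable_spinMonomial' μ y]
  exact Finset.sum_congr rfl fun y _ => (criticalCorr_eq_integral_spinMonomial hcorr y).symm

/-- **Tilted sums are axis sums composed with `ψ⁻¹`.** Under `TiltGeometry`, for block indices `w` inside the window
(`|wₗᵢ| ≤ m`) and any function `F` of configurations,
`Σ_{y ∈ ∏ₗ tiltCell n m wₗ} F(y) = Σ_{y ∈ ∏ₗ axisCell n wₗ} F(ψ⁻¹ ∘ y)`. [folklore] -/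
theorem sum_piFinset_tiltCell_eq (hTG : TiltGeometry) {k : ℕ} (n m : ℕ) (w : Fin k → (Fin 3 → ℤ))
    (hw : ∀ l i, |w l i| ≤ m) (F : (Fin k → Site 3) → ℝ) :
    ∑ y ∈ Fintype.piFinset (fun l => tiltCell n m (w l)), F y =
      ∑ y ∈ Fintype.piFinset (fun l => axisCell n (w l)), F (fun l => psiInv (y l)) := by
  classical
  obtain ⟨-, h2, -, h4, -⟩ := hTG
  have hinj : Function.Injective psiInv := fun x x' h => by
    have := congrArg psi h; rwa [h2, h2] at this
  have hcells : (fun l => tiltCell n m (w l)) = fun l => (axisCell n (w l)).image psiInv :=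
    funext fun l => h4 n m (w l) (hw l)
  rw [hcells, Fintype.piFinset_image (fun _ => psiInv) (fun l => axisCell n (w l)), Finset.sum_image]
  rintro y - y' - hyy
  funext l
  exact hinj (congrFun hyy l)

end Summit.CriticalPhenomena.Ising3DConformalLimit.Cruxes.RotationJoining.RateSplitting

end
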